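import Summits.ValiantsHypothesis.ValiantsHypothesis.Theorems.TwoProducts.RankThreeAffineBinomial

/-!
# Rank three AFFINE, T1-A′: the Fermat trinomial `nv (w₀^a + ρ·w₁^b − κ·w₂^d) ≤ c(t)` by a DEPTH-2 derivation chain

FILE B of crit-8 g4's T1-A′ split (rulings #66/#68/#70, 2026-08-29): the CLIENT.  FILE A (`…RankTwoJacobianShiftedAxial`, val-port-1 g5) supplies
the ENGINE — the shifted axial transfer and its per-cell count; until it lands this file takes that engine as ONE `Prop` hypothesis
`ShiftedAxialBound` (K1 pattern of record: P2–P4 took `AxialTransfer` / `Ostrowski` as arguments before P1 discharged them), so every headline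
here is CONDITIONAL on `ShiftedAxialBound` and becomes unconditional by a five-line discharge once FILE A is ✓.  SIDE-LADDER located instance
of the OPEN rung 3-AFF (`…Cruxes.TwoProducts.ValIdea35g10.RankThreeAffineLaw`); NOT γ; `TwoProducts` (5906), `PlanarCellBound`, `ResidualLawV25`
UNMOVED; 0 summit distance; VP ≠ VNP is NOT proved here or anywhere in this tree.  `--supports stmt-ValiantsHypothesis-5906 --as helper`;
val-port-4 g4; desk #535 (A)/#542 (E); director R398 (2).

THE CHAIN (`N = w₀^a + ρ·w₁^b − κ·w₂^d`, `U = w₀^a`, `V = ρ·w₁^b`, `jᵢₖ = J(wᵢ, wₖ)`).  (i) `J(·, w₂)` kills `κ·w₂^d` (✓ `jac_C_mul_pow_self`)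
and `w₀·w₁·J(N, w₂) = α·U + β·V` with the sparse `α = a·w₁·j₀₂`, `β = b·w₀·j₁₂` (★ `trinomial_jac_identity`).  (ii) The Wronskian of
`E₂ = αU + βV` and `β` against `w₁` kills `V` (`J(V, w₁) = 0`): `w₀·(β·J(E₂, w₁) − E₂·J(β, w₁)) = U·S″`,
`S″ = w₀(β·J(α,w₁) − α·J(β,w₁)) + a·α·β·j₀₁`, `|supp S″| ≤ 3t⁸` (★ `shifted_wronskian_identity`, `card_support_S2_le`).
(iii) ✓ `Eset_subset_of_axial` (step (i), carrier `w₂`) then `ShiftedAxialBound` (step (ii), carrier `w₁`, top-cut `G = β`) and ✓ `ostrowski`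
put every edge direction of `N` into `Xc(w₂) ∪ Spec(w₂,N) ∪ Xc(w₁) ∪ Eset β ∪ SS ∪ Eset(w₀) ∪ Eset S″` (★ `card_Eset_trinomial_main`); the
degenerate corners (`ρ = 0`, `U = 0`, `V = 0` ⇒ ✓ `card_Eset_binomialAffine_le`; `α = 0` or `β = 0` ⇒ one step; `w₂` constant ⇒ carrier `w₁`,
then `w₀`, then ✓ `Eset_C`; `a = 0` / `b = 0` ⇒ that carrier replaced by `1`) give ★ `card_Eset_trinomialAffine_le :
|Eset σ N| ≤ 9t¹⁶ + 4t⁶ + 7t² + 6t + 4` ⇒ ★★ `trinomialAffine_nv_le` (uniform in `a, b, d, ρ, κ`) ⇒ `trinomialAffineLaw_of :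
ShiftedAxialBound → TrinomialAffineLaw` (`c = 22`; `TrinomialAffineLaw` = crit-8 #63 verbatim with `ρ` for `λ`).
No instances, no notation, no named facts. [folklore]
-/

noncomputable section
set_option linter.dupNamespace false

namespace Summit.ValiantsHypothesis.ValiantsHypothesis.Theorems.TwoProducts.RankTwoJacobian

open scoped BigOperators Pointwise Classical
open MvPolynomial

/-! ### §1 The engine interface (FILE A) as one `Prop` -/

/-- **The shifted axial bound** — FILE A's one-call template `Eset_subset_of_shifted` together with its count `card_SpecShift_le`
(val-port-1 g5, `…RankTwoJacobianShiftedAxial`, defs D1–D4 of 2026-08-29T07:06:21Z), packaged as a hypothesis: for a non-constant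
carrier `v`, a top-cut `G ≠ 0`, a multiplier `M ≠ 0` and an identity `M·(G·J(N,v) − N·J(G,v)) = F′·Br`, the edge directions of `N` in the
chart `σ` lie in `Xc σ v`, the tie values of `G`, a set `SS` of at most `2(|Xc σ v| + |Eset σ G| + 1)` shift-special values, or the edge
directions of `F′` or `Br`.  Discharged by import (`SS := SpecShift σ v G N`) when FILE A lands; NOT asserted here. -/
def ShiftedAxialBound : Prop :=
  ∀ σ : ℝ, (σ = 1 ∨ σ = -1) → ∀ (v G N M F' Br : Poly2), (S1 v).Nonempty → G ≠ 0 → M ≠ 0 →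
    M * (G * jac N v - N * jac G v) = F' * Br →
    ∃ SS : Finset ℝ, SS.card ≤ 2 * ((Xc σ v).card + (Eset σ G).card + 1) ∧
      Eset σ N ⊆ Xc σ v ∪ Eset σ G ∪ SS ∪ (Eset σ F' ∪ Eset σ Br)

/-! ### §2 The two identities of the chain -/

/-- `J(A + B, v) = J(A, v) + J(B, v)`. [folklore] -/
theorem jac_add_left (A B v : Poly2) : jac (A + B) v = jac A v + jac B v := by
  rw [← jacDer_apply, ← jacDer_apply, ← jacDer_apply, map_add]

/-- `J(c·A, v) = c·J(A, v)`. [folklore] -/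
theorem jac_C_mul_left (c : ℂ) (A v : Poly2) : jac (C c * A) v = C c * jac A v := by
  rw [jac_mul_left, jac_C_left, mul_zero, add_zero]

/-- ★ **Step (i): `w₀·w₁·J(w₀^a + ρ w₁^b − κ w₂^d, w₂) = α·w₀^a + β·(ρ w₁^b)`** with `α = a·w₁·J(w₀,w₂)`, `β = b·w₀·J(w₁,w₂)` — the third
power dies under `J(·, w₂)`. [folklore] -/
theorem trinomial_jac_identity (w₀ w₁ w₂ : Poly2) (a b d : ℕ) (ρ κ : ℂ) :
    w₀ * w₁ * jac (w₀ ^ a + C ρ * w₁ ^ b - C κ * w₂ ^ d) w₂ =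
      C (a : ℂ) * (w₁ * jac w₀ w₂) * w₀ ^ a + C (b : ℂ) * (w₀ * jac w₁ w₂) * (C ρ * w₁ ^ b) := by
  rw [jac_sub_left, jac_C_mul_pow_self, sub_zero, jac_add_left, jac_C_mul_left]
  have h0 := jac_pow_mul w₀ w₂ a
  have h1 := jac_pow_mul w₁ w₂ b
  linear_combination w₁ * h0 + C ρ * w₀ * h1

/-- ★ **Step (ii): the shifted Wronskian identity.** If `J(V, w₁) = 0` and `J(U, w₁)·w₀ = a·U·J(w₀,w₁)` then
`w₀·(β·J(αU + βV, w₁) − (αU + βV)·J(β, w₁)) = U·(w₀(β J(α,w₁) − α J(β,w₁)) + a·α·β·J(w₀,w₁))`. [folklore] -/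
theorem shifted_wronskian_identity (α β U V w₀ w₁ : Poly2) (a : ℕ) (hV : jac V w₁ = 0)
    (hU : jac U w₁ * w₀ = C (a : ℂ) * (U * jac w₀ w₁)) :
    w₀ * (β * jac (α * U + β * V) w₁ - (α * U + β * V) * jac β w₁) =
      U * (w₀ * (β * jac α w₁ - α * jac β w₁) + C (a : ℂ) * (α * β * jac w₀ w₁)) := by
  rw [jac_add_left, jac_mul_left, jac_mul_left, hV, mul_zero, zero_add]
  linear_combination α * β * hU

/-! ### §3 Support bookkeeping -/

/-- `|supp (c·X)| ≤ |supp X|`. [folklore] -/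
theorem card_supp_C_mul_le (c : ℂ) (X : Poly2) : (C c * X).support.card ≤ X.support.card := by
  refine Finset.card_le_card fun s hs => ?_
  rw [MvPolynomial.mem_support_iff, coeff_C_mul] at hs
  exact MvPolynomial.mem_support_iff.mpr (right_ne_zero_of_mul hs)

/-- `|supp (X·Y)| ≤ |supp X|·|supp Y|`. [folklore] -/
theorem card_supp_mul_le (X Y : Poly2) : (X * Y).support.card ≤ X.support.card * Y.support.card :=
  (Finset.card_le_card (MvPolynomial.support_mul X Y)).trans Finset.card_add_le

/-- `|supp (X − Y)| ≤ |supp X| + |supp Y|`. [folklore] -/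
theorem card_supp_sub_le (X Y : Poly2) : (X - Y).support.card ≤ X.support.card + Y.support.card :=
  (Finset.card_le_card (MvPolynomial.support_sub _ X Y)).trans (Finset.card_union_le _ _)

/-- `|supp (X + Y)| ≤ |supp X| + |supp Y|`. [folklore] -/
theorem card_supp_add_le (X Y : Poly2) : (X + Y).support.card ≤ X.support.card + Y.support.card :=
  (Finset.card_le_card MvPolynomial.support_add).trans (Finset.card_union_le _ _)

/-- `|Eset σ F| ≤ s²` whenever `|supp F| ≤ s` (✓ `card_Eset_le`). [folklore] -/
theorem card_Eset_le_sq (σ : ℝ) (F : Poly2) {s : ℕ} (h : F.support.card ≤ s) : (Eset σ F).card ≤ s * s :=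
  (card_Eset_le σ F).trans (Nat.mul_le_mul h h)

/-- `|supp S″| ≤ 3t⁸` for the residual bracket of step (ii). [folklore] -/
theorem card_support_S2_le {t : ℕ} (w₀ w₁ w₂ : Poly2) (h0 : w₀.support.card ≤ t) (h1 : w₁.support.card ≤ t)
    (h2 : w₂.support.card ≤ t) (a b : ℕ) :
    (w₀ * (C (b : ℂ) * (w₀ * jac w₁ w₂) * jac (C (a : ℂ) * (w₁ * jac w₀ w₂)) w₁
        - C (a : ℂ) * (w₁ * jac w₀ w₂) * jac (C (b : ℂ) * (w₀ * jac w₁ w₂)) w₁)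
      + C (a : ℂ) * (C (a : ℂ) * (w₁ * jac w₀ w₂) * (C (b : ℂ) * (w₀ * jac w₁ w₂)) * jac w₀ w₁)).support.card ≤ 3 * t ^ 8 := by
  set α : Poly2 := C (a : ℂ) * (w₁ * jac w₀ w₂) with hα
  set β : Poly2 := C (b : ℂ) * (w₀ * jac w₁ w₂) with hβ
  have hαs : α.support.card ≤ t ^ 3 :=
    (card_supp_C_mul_le _ _).trans ((card_supp_mul_le _ _).trans
      ((Nat.mul_le_mul h1 ((card_support_jac_le w₀ w₂).trans (Nat.mul_le_mul h0 h2))).trans (by ring_nf; exact le_rfl)))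
  have hβs : β.support.card ≤ t ^ 3 :=
    (card_supp_C_mul_le _ _).trans ((card_supp_mul_le _ _).trans
      ((Nat.mul_le_mul h0 ((card_support_jac_le w₁ w₂).trans (Nat.mul_le_mul h1 h2))).trans (by ring_nf; exact le_rfl)))
  have hjα : (jac α w₁).support.card ≤ t ^ 3 * t := (card_support_jac_le α w₁).trans (Nat.mul_le_mul hαs h1)
  have hjβ : (jac β w₁).support.card ≤ t ^ 3 * t := (card_support_jac_le β w₁).trans (Nat.mul_le_mul hβs h1)
  have h1' : (β * jac α w₁).support.card ≤ t ^ 3 * (t ^ 3 * t) := (card_supp_mul_le _ _).trans (Nat.mul_le_mul hβs hjα)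
  have h2' : (α * jac β w₁).support.card ≤ t ^ 3 * (t ^ 3 * t) := (card_supp_mul_le _ _).trans (Nat.mul_le_mul hαs hjβ)
  have h3' : (w₀ * (β * jac α w₁ - α * jac β w₁)).support.card ≤ t * (t ^ 3 * (t ^ 3 * t) + t ^ 3 * (t ^ 3 * t)) :=
    (card_supp_mul_le _ _).trans (Nat.mul_le_mul h0 ((card_supp_sub_le _ _).trans (Nat.add_le_add h1' h2')))
  have h4' : (C (a : ℂ) * (α * β * jac w₀ w₁)).support.card ≤ t ^ 3 * t ^ 3 * (t * t) :=
    (card_supp_C_mul_le _ _).trans ((card_supp_mul_le _ _).trans (Nat.mul_le_mul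
      ((card_supp_mul_le _ _).trans (Nat.mul_le_mul hαs hβs)) ((card_support_jac_le w₀ w₁).trans (Nat.mul_le_mul h0 h1))))
  refine (card_supp_add_le _ _).trans ((Nat.add_le_add h3' h4').trans ?_)
  ring_nf
  exact le_rfl

/-- One axial step, counted: `|Eset σ N| ≤ 2t⁶ + 3t² + 3t + 2` when `Eset σ N ⊆ Xc σ v ∪ Spec σ v N ∪ (Eset σ F ∪ Eset σ Br)` with
`|Eset σ F|, |Eset σ Br| ≤ t⁶` (✓ `card_Xc_le`, ✓ `card_Spec_le`). [folklore] -/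
theorem card_Eset_le_one_step {σ : ℝ} (hσ : σ = 1 ∨ σ = -1) {t : ℕ} {v N F Br : Poly2} (hv : v.support.card ≤ t)
    (hsub : Eset σ N ⊆ Xc σ v ∪ Spec σ v N ∪ (Eset σ F ∪ Eset σ Br)) (hF : (Eset σ F).card ≤ t ^ 6)
    (hBr : (Eset σ Br).card ≤ t ^ 6) : (Eset σ N).card ≤ 2 * t ^ 6 + 3 * t ^ 2 + 3 * t + 2 := by
  have hX : (Xc σ v).card ≤ t * t + t := (card_Xc_le σ v).trans (Nat.add_le_add (Nat.mul_le_mul hv hv) hv)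
  have hSp := card_Spec_le hσ v N
  have h := (Finset.card_le_card hsub).trans ((Finset.card_union_le _ _).trans
    (Nat.add_le_add (Finset.card_union_le _ _) (Finset.card_union_le _ _)))
  have htt : t * t = t ^ 2 := by ring
  rw [htt] at hX
  omega

/-! ### §4 The main chain: `w₂` non-constant, `w₀ ≠ 0`, `w₁ ≠ 0` -/

/-- ★ **Main chain.** If `w₂` is non-constant and `w₀, w₁ ≠ 0` then, under `ShiftedAxialBound`,
`|Eset σ (w₀^a + ρ w₁^b − κ w₂^d)| ≤ 9t¹⁶ + 4t⁶ + 7t² + 6t + 4`. -/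
theorem card_Eset_trinomial_main {σ : ℝ} (hσ : σ = 1 ∨ σ = -1) (hSA : ShiftedAxialBound) {t : ℕ} (w : Fin 3 → Poly2)
    (hw : ∀ i, (w i).support.card ≤ t) (a b d : ℕ) (ρ κ : ℂ) (hS2 : (S1 (w 2)).Nonempty) (hw0 : w 0 ≠ 0) (hw1 : w 1 ≠ 0) :
    (Eset σ (w 0 ^ a + C ρ * w 1 ^ b - C κ * w 2 ^ d)).card ≤ 9 * t ^ 16 + 4 * t ^ 6 + 7 * t ^ 2 + 6 * t + 4 := by
  set N : Poly2 := w 0 ^ a + C ρ * w 1 ^ b - C κ * w 2 ^ d with hN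
  set α : Poly2 := C (a : ℂ) * (w 1 * jac (w 0) (w 2)) with hα
  set β : Poly2 := C (b : ℂ) * (w 0 * jac (w 1) (w 2)) with hβ
  set U : Poly2 := w 0 ^ a with hU
  set V : Poly2 := C ρ * w 1 ^ b with hV
  have hid1 : w 0 * w 1 * jac N (w 2) = α * U + β * V := trinomial_jac_identity (w 0) (w 1) (w 2) a b d ρ κ
  have hM1 : w 0 * w 1 ≠ 0 := mul_ne_zero hw0 hw1
  -- sizes
  have hαs : α.support.card ≤ t ^ 3 :=
    (card_supp_C_mul_le _ _).trans ((card_supp_mul_le _ _).trans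
      ((Nat.mul_le_mul (hw 1) ((card_support_jac_le (w 0) (w 2)).trans (Nat.mul_le_mul (hw 0) (hw 2)))).trans
        (by ring_nf; exact le_rfl)))
  have hβs : β.support.card ≤ t ^ 3 :=
    (card_supp_C_mul_le _ _).trans ((card_supp_mul_le _ _).trans
      ((Nat.mul_le_mul (hw 0) ((card_support_jac_le (w 1) (w 2)).trans (Nat.mul_le_mul (hw 1) (hw 2)))).trans
        (by ring_nf; exact le_rfl)))
  have e6 : t ^ 3 * t ^ 3 = t ^ 6 := by ring
  have hEα : (Eset σ α).card ≤ t ^ 6 := e6 ▸ card_Eset_le_sq σ α hαs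
  have hEβ : (Eset σ β).card ≤ t ^ 6 := e6 ▸ card_Eset_le_sq σ β hβs
  have e2 : t * t = t ^ 2 := by ring
  have hE0 : (Eset σ (w 0)).card ≤ t ^ 2 := e2 ▸ card_Eset_le_sq σ (w 0) (hw 0)
  have hE1 : (Eset σ (w 1)).card ≤ t ^ 2 := e2 ▸ card_Eset_le_sq σ (w 1) (hw 1)
  have hEU : (Eset σ U).card ≤ t ^ 6 := by
    refine ((Finset.card_le_card (Eset_pow_subset hσ (w 0) a)).trans hE0).trans ?_
    calc t ^ 2 ≤ t ^ 2 * 1 := by omega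
      _ ≤ t ^ 6 := by
          rcases Nat.eq_zero_or_pos t with rfl | ht
          · simp
          · calc t ^ 2 * 1 ≤ t ^ 2 * t ^ 4 := Nat.mul_le_mul_left _ (Nat.one_le_pow _ _ ht)
              _ = t ^ 6 := by ring
  have hEV : (Eset σ V).card ≤ t ^ 6 := by
    have hV1 : (Eset σ V).card ≤ t ^ 2 := by
      by_cases hρ : ρ = 0
      · rw [hV, hρ, C_0, zero_mul, Eset_zero]; simp
      · rw [hV, Eset_C_mul σ hρ]
        exact (Finset.card_le_card (Eset_pow_subset hσ (w 1) b)).trans hE1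
    refine hV1.trans ?_
    rcases Nat.eq_zero_or_pos t with rfl | ht
    · simp
    · calc t ^ 2 = t ^ 2 * 1 := by ring
        _ ≤ t ^ 2 * t ^ 4 := Nat.mul_le_mul_left _ (Nat.one_le_pow _ _ ht)
        _ = t ^ 6 := by ring
  -- ONE STEP when `E₂ = αU + βV` is a single product
  by_cases hα0 : α = 0
  · have hid : w 0 * w 1 * jac N (w 2) = β * V := by rw [hid1, hα0, zero_mul, zero_add]
    have h := card_Eset_le_one_step hσ (hw 2) (Eset_subset_of_axial hσ hS2 hM1 hid) hEβ hEV
    omega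
  by_cases hβ0 : β = 0
  · have hid : w 0 * w 1 * jac N (w 2) = α * U := by rw [hid1, hβ0, zero_mul, add_zero]
    have h := card_Eset_le_one_step hσ (hw 2) (Eset_subset_of_axial hσ hS2 hM1 hid) hEα hEU
    omega
  -- TWO STEPS.  Step 1 (carrier `w 2`): `Eset N ⊆ Xc(w₂) ∪ Spec(w₂, N) ∪ Eset E₂`
  have hid : w 0 * w 1 * jac N (w 2) = (α * U + β * V) * 1 := by rw [mul_one]; exact hid1
  have hsub1 := Eset_subset_of_axial hσ hS2 hM1 hid
  have hE1e : Eset σ (1 : Poly2) = ∅ := by rw [← C_1, Eset_C]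
  rw [hE1e, Finset.union_empty] at hsub1
  -- Step 2 (carrier `w 1`, top-cut `β`): `w 1` is non-constant since `β ≠ 0`
  have hS1 : (S1 (w 1)).Nonempty := by
    by_contra h
    apply hβ0
    rw [hβ, eq_C_of_S1_empty h, jac_C_left, mul_zero, mul_zero]
  have hVj : jac V (w 1) = 0 := jac_C_mul_pow_self ρ (w 1) b
  have hUj : jac U (w 1) * w 0 = C (a : ℂ) * (U * jac (w 0) (w 1)) := jac_pow_mul (w 0) (w 1) a
  have hid2 := shifted_wronskian_identity α β U V (w 0) (w 1) a hVj hUj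
  obtain ⟨SS, hSS, hsub2⟩ := hSA σ hσ (w 1) β (α * U + β * V) (w 0) U _ hS1 hβ0 hw0 hid2
  have hS2s := card_support_S2_le (w 0) (w 1) (w 2) (hw 0) (hw 1) (hw 2) a b
  have hES : (Eset σ (w 0 * (β * jac α (w 1) - α * jac β (w 1)) + C (a : ℂ) * (α * β * jac (w 0) (w 1)))).card ≤ 9 * t ^ 16 := by
    have h := card_Eset_le_sq σ _ hS2s
    have e : 3 * t ^ 8 * (3 * t ^ 8) = 9 * t ^ 16 := by ring
    rw [e] at h
    exact h
  have hX2 : (Xc σ (w 2)).card ≤ t * t + t := (card_Xc_le σ (w 2)).trans (Nat.add_le_add (Nat.mul_le_mul (hw 2) (hw 2)) (hw 2))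
  have hX1 : (Xc σ (w 1)).card ≤ t * t + t := (card_Xc_le σ (w 1)).trans (Nat.add_le_add (Nat.mul_le_mul (hw 1) (hw 1)) (hw 1))
  have hSp := card_Spec_le hσ (w 2) N
  have hEU' : (Eset σ U).card ≤ t ^ 2 := (Finset.card_le_card (Eset_pow_subset hσ (w 0) a)).trans hE0
  have hcE2 := (Finset.card_le_card hsub2).trans ((Finset.card_union_le _ _).trans (Nat.add_le_add
    ((Finset.card_union_le _ _).trans (Nat.add_le_add (Finset.card_union_le _ _) le_rfl)) (Finset.card_union_le _ _)))
  have hcN := (Finset.card_le_card hsub1).trans ((Finset.card_union_le _ _).trans (Nat.add_le_add (Finset.card_union_le _ _) le_rfl))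
  rw [e2] at hX2 hX1
  omega

/-! ### §5 All corners, the headline, and the law -/

/-- A carrier replaced by `1` when its exponent is `0` (then the power is `1` either way). -/
theorem pow_ite_one_eq (A : Poly2) (n : ℕ) : (if n = 0 then (1 : Poly2) else A) ^ n = A ^ n := by
  by_cases h : n = 0
  · rw [if_pos h, h, pow_zero, pow_zero]
  · rw [if_neg h]

/-- ★ **Per chart: `|Eset σ (w₀^a + ρ·w₁^b − κ·w₂^d)| ≤ 9t¹⁶ + 4t⁶ + 7t² + 6t + 4`** for `t`-sparse carriers, under `ShiftedAxialBound`. -/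
theorem card_Eset_trinomialAffine_le {σ : ℝ} (hσ : σ = 1 ∨ σ = -1) (hSA : ShiftedAxialBound) {t : ℕ} (w : Fin 3 → Poly2)
    (hw : ∀ i, (w i).support.card ≤ t) (a b d : ℕ) (ρ κ : ℂ) :
    (Eset σ (w 0 ^ a + C ρ * w 1 ^ b - C κ * w 2 ^ d)).card ≤ 9 * t ^ 16 + 4 * t ^ 6 + 7 * t ^ 2 + 6 * t + 4 := by
  -- `t = 0`: all carriers vanish and `N` is a constant
  rcases Nat.eq_zero_or_pos t with ht0 | htpos
  · have hz : ∀ i, w i = 0 := fun i => by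
      have h := hw i
      rw [ht0, Nat.le_zero, Finset.card_eq_zero, MvPolynomial.support_eq_empty] at h
      exact h
    have hN : w 0 ^ a + C ρ * w 1 ^ b - C κ * w 2 ^ d = C (0 ^ a + ρ * 0 ^ b - κ * 0 ^ d) := by
      rw [hz 0, hz 1, hz 2, ← C_0, ← map_pow, ← map_pow, ← map_pow, ← map_mul, ← map_mul, ← map_add, ← map_sub]
    rw [hN, Eset_C]; simp
  have hbin : ∀ (w' : Fin 3 → Poly2), (∀ i, (w' i).support.card ≤ t) → ∀ (a' b' : ℕ) (κ' : ℂ),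
      (Eset σ (w' 0 ^ a' * w' 1 ^ b' - C κ' * w' 2 ^ d)).card ≤ 9 * t ^ 16 + 4 * t ^ 6 + 7 * t ^ 2 + 6 * t + 4 :=
    fun w' hw' a' b' κ' => (card_Eset_binomialAffine_le hσ w' hw' a' b' d κ').trans (by omega)
  have hC1 : ∀ c : ℂ, (C c : Poly2).support.card ≤ t := fun c =>
    (Finset.card_le_card (MvPolynomial.support_monomial_subset)).trans (by rw [Finset.card_singleton]; exact htpos)
  -- `ρ = 0`: a binomial with `b = 0`
  by_cases hρ : ρ = 0
  · have hN : w 0 ^ a + C ρ * w 1 ^ b - C κ * w 2 ^ d = w 0 ^ a * w 1 ^ 0 - C κ * w 2 ^ d := by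
      rw [hρ, C_0, zero_mul, add_zero, pow_zero, mul_one]
    rw [hN]; exact hbin w hw a 0 κ
  -- `U = 0`: a binomial in the carriers `(C ρ, w 1, w 2)` with exponents `(1, b)`
  by_cases hU0 : w 0 ^ a = 0
  · have hN : w 0 ^ a + C ρ * w 1 ^ b - C κ * w 2 ^ d
        = (![C ρ, w 1, w 2] : Fin 3 → Poly2) 0 ^ 1 * (![C ρ, w 1, w 2] : Fin 3 → Poly2) 1 ^ b
          - C κ * (![C ρ, w 1, w 2] : Fin 3 → Poly2) 2 ^ d := by
      simp only [Matrix.cons_val_zero, Matrix.cons_val_one, Matrix.cons_val_two, Matrix.head_cons, Matrix.tail_cons, pow_one]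
      rw [hU0, zero_add]
    rw [hN]
    refine hbin _ (fun i => ?_) 1 b κ
    fin_cases i
    · exact hC1 ρ
    · exact hw 1
    · exact hw 2
  -- `V`'s power vanishes: a binomial with `b = 0`
  by_cases hV0 : w 1 ^ b = 0
  · have hN : w 0 ^ a + C ρ * w 1 ^ b - C κ * w 2 ^ d = w 0 ^ a * w 1 ^ 0 - C κ * w 2 ^ d := by
      rw [hV0, mul_zero, add_zero, pow_zero, mul_one]
    rw [hN]; exact hbin w hw a 0 κ
  -- replace a carrier by `1` when its exponent is `0`; the new carriers `w'` are nonzero and `t`-sparse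
  set w' : Fin 3 → Poly2 := ![if a = 0 then 1 else w 0, if b = 0 then 1 else w 1, w 2] with hw'
  have hw'0 : w' 0 = if a = 0 then 1 else w 0 := rfl
  have hw'1 : w' 1 = if b = 0 then 1 else w 1 := rfl
  have hw'2 : w' 2 = w 2 := rfl
  have hsp : ∀ i, (w' i).support.card ≤ t := by
    intro i
    fin_cases i
    · show (w' 0).support.card ≤ t
      rw [hw'0]; split_ifs
      · rw [← C_1]; exact hC1 1
      · exact hw 0
    · show (w' 1).support.card ≤ t
      rw [hw'1]; split_ifs
      · rw [← C_1]; exact hC1 1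
      · exact hw 1
    · exact hw 2
  have hne0 : w' 0 ≠ 0 := by
    rw [hw'0]; split_ifs with h
    · exact one_ne_zero
    · intro hz; exact hU0 (by rw [hz, zero_pow h])
  have hne1 : w' 1 ≠ 0 := by
    rw [hw'1]; split_ifs with h
    · exact one_ne_zero
    · intro hz; exact hV0 (by rw [hz, zero_pow h])
  have hNw' : w 0 ^ a + C ρ * w 1 ^ b - C κ * w 2 ^ d = w' 0 ^ a + C ρ * w' 1 ^ b - C κ * w' 2 ^ d := by
    rw [hw'0, hw'1, hw'2, pow_ite_one_eq, pow_ite_one_eq]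
  rw [hNw']
  -- main chain when `w 2` is non-constant
  by_cases hS2 : (S1 (w' 2)).Nonempty
  · exact card_Eset_trinomial_main hσ hSA w' hsp a b d ρ κ hS2 hne0 hne1
  -- `w 2` constant: `κ·w₂^d` is a constant; carrier `w' 1`, then `w' 0`, then everything is constant
  have hK : C κ * w' 2 ^ d = C (κ * coeff 0 (w' 2) ^ d) := by
    rw [eq_C_of_S1_empty hS2, coeff_C, if_pos rfl, ← map_pow, ← map_mul]
  have hX : ∀ i, (Xc σ (w' i)).card ≤ t ^ 2 + t := fun i =>
    (card_Xc_le σ (w' i)).trans (by nlinarith [hsp i])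
  have hE0 : (Eset σ (w' 0 ^ a)).card ≤ t ^ 6 := by
    refine ((Finset.card_le_card (Eset_pow_subset hσ (w' 0) a)).trans (card_Eset_le_sq σ (w' 0) (hsp 0))).trans ?_
    calc t * t = t ^ 2 * 1 := by ring
      _ ≤ t ^ 2 * t ^ 4 := Nat.mul_le_mul_left _ (Nat.one_le_pow _ _ htpos)
      _ = t ^ 6 := by ring
  by_cases hS1 : (S1 (w' 1)).Nonempty
  · -- carrier `w' 1`, multiplier `w' 0`: `w'₀·J(N, w'₁) = (a·J(w'₀,w'₁))·U'`
    have hid : w' 0 * jac (w' 0 ^ a + C ρ * w' 1 ^ b - C κ * w' 2 ^ d) (w' 1) = (C (a : ℂ) * jac (w' 0) (w' 1)) * w' 0 ^ a := by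
      rw [hK, jac_sub_left, jac_C_left, sub_zero, jac_add_left, jac_C_mul_pow_self, add_zero, mul_comm, jac_pow_mul]
      ring
    have hEj : (Eset σ (C (a : ℂ) * jac (w' 0) (w' 1))).card ≤ t ^ 6 := by
      by_cases ha : (a : ℂ) = 0
      · rw [ha, C_0, zero_mul, Eset_zero]; simp
      · rw [Eset_C_mul σ ha]
        refine (card_Eset_le_sq σ _ ((card_support_jac_le (w' 0) (w' 1)).trans (Nat.mul_le_mul (hsp 0) (hsp 1)))).trans ?_
        calc t * t * (t * t) = t ^ 4 * 1 := by ring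
          _ ≤ t ^ 4 * t ^ 2 := Nat.mul_le_mul_left _ (Nat.one_le_pow _ _ htpos)
          _ = t ^ 6 := by ring
    have h := card_Eset_le_one_step hσ (hsp 1) (Eset_subset_of_axial hσ hS1 hne0 hid) hEj hE0
    omega
  -- `w' 1` constant as well: carrier `w' 0`, multiplier `1`, `J(N, w'₀) = 0`
  have hV' : C ρ * w' 1 ^ b = C (ρ * coeff 0 (w' 1) ^ b) := by
    rw [eq_C_of_S1_empty hS1, coeff_C, if_pos rfl, ← map_pow, ← map_mul]
  by_cases hS0 : (S1 (w' 0)).Nonempty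
  · have hid : 1 * jac (w' 0 ^ a + C ρ * w' 1 ^ b - C κ * w' 2 ^ d) (w' 0) = 0 * 0 := by
      rw [hK, hV', jac_sub_left, jac_C_left, sub_zero, jac_add_left, jac_C_left, add_zero, one_mul, mul_zero,
        ← one_mul (w' 0 ^ a), ← C_1, jac_C_mul_pow_self]
    have h := card_Eset_le_one_step hσ (hsp 0) (Eset_subset_of_axial hσ hS0 one_ne_zero hid)
      (by rw [Eset_zero]; simp) (by rw [Eset_zero]; simp)
    omega
  -- all three carriers constant
  have hU' : w' 0 ^ a = C (coeff 0 (w' 0) ^ a) := by rw [eq_C_of_S1_empty hS0, coeff_C, if_pos rfl, ← map_pow]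
  rw [hK, hV', hU', ← map_add, ← map_sub, Eset_C]
  simp

/-- ★★ **T1-A′ — the Fermat trinomial, uniform (conditional on FILE A's `ShiftedAxialBound`).** For `t`-sparse carriers `w₀, w₁, w₂ ∈ ℂ[x,y]` and
ANY `a, b, d : ℕ`, `ρ, κ : ℂ`: `nv (w₀^a + ρ·w₁^b − κ·w₂^d) ≤ 2·(9t¹⁶ + 4t⁶ + 7t² + 6t + 4) + 4`. -/
theorem trinomialAffine_nv_le (hSA : ShiftedAxialBound) {t : ℕ} (w : Fin 3 → Poly2) (hw : ∀ i, (w i).support.card ≤ t)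
    (a b d : ℕ) (ρ κ : ℂ) :
    nv (w 0 ^ a + C ρ * w 1 ^ b - C κ * w 2 ^ d) ≤ 2 * (9 * t ^ 16 + 4 * t ^ 6 + 7 * t ^ 2 + 6 * t + 4) + 4 := by
  have h1 := card_Eset_trinomialAffine_le (σ := 1) (Or.inl rfl) hSA w hw a b d ρ κ
  have h2 := card_Eset_trinomialAffine_le (σ := -1) (Or.inr rfl) hSA w hw a b d ρ κ
  have h := nv_le (w 0 ^ a + C ρ * w 1 ^ b - C κ * w 2 ^ d)
  omega

/-- The Fermat-trinomial law (crit-8 g4's T1-A′, ruling #63 verbatim with `ρ` for `λ`): `nv (w₀^a + ρ w₁^b − κ w₂^d) ≤ (a+b+d+2)^c (t+2)^c` for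
some absolute `c`.  NOT asserted; PROVED below CONDITIONALLY on `ShiftedAxialBound` (`trinomialAffineLaw_of`, `c = 22`). -/
def TrinomialAffineLaw : Prop :=
  ∃ c : ℕ, ∀ (a b d t : ℕ) (ρ κ : ℂ) (w : Fin 3 → Poly2), (∀ i, (w i).support.card ≤ t) →
    nv (w 0 ^ a + C ρ * w 1 ^ b - C κ * w 2 ^ d) ≤ (a + b + d + 2) ^ c * (t + 2) ^ c

/-- Arithmetic: `2·(9t¹⁶ + 4t⁶ + 7t² + 6t + 4) + 4 ≤ (t+2)^22`. [folklore] -/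
theorem trinomial_arith (t : ℕ) : 2 * (9 * t ^ 16 + 4 * t ^ 6 + 7 * t ^ 2 + 6 * t + 4) + 4 ≤ (t + 2) ^ 22 := by
  have h16 : t ^ 16 ≤ (t + 2) ^ 16 := Nat.pow_le_pow_left (by omega) 16
  have h6 : t ^ 6 ≤ (t + 2) ^ 16 := (Nat.pow_le_pow_left (by omega) 6).trans (Nat.pow_le_pow_right (by omega) (by omega))
  have h2 : t ^ 2 ≤ (t + 2) ^ 16 := (Nat.pow_le_pow_left (by omega) 2).trans (Nat.pow_le_pow_right (by omega) (by omega))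
  have h1 : t ≤ (t + 2) ^ 16 := by
    calc t = t ^ 1 := (pow_one t).symm
      _ ≤ (t + 2) ^ 1 := Nat.pow_le_pow_left (by omega) 1
      _ ≤ (t + 2) ^ 16 := Nat.pow_le_pow_right (by omega) (by omega)
  have h0 : 1 ≤ (t + 2) ^ 16 := Nat.one_le_pow _ _ (by omega)
  have h64 : 64 ≤ (t + 2) ^ 6 := by
    calc 64 = 2 ^ 6 := by norm_num
      _ ≤ (t + 2) ^ 6 := Nat.pow_le_pow_left (by omega) 6
  calc 2 * (9 * t ^ 16 + 4 * t ^ 6 + 7 * t ^ 2 + 6 * t + 4) + 4 ≤ 64 * (t + 2) ^ 16 := by omega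
    _ ≤ (t + 2) ^ 6 * (t + 2) ^ 16 := Nat.mul_le_mul_right _ h64
    _ = (t + 2) ^ 22 := by rw [← pow_add]

/-- ★ **`TrinomialAffineLaw` holds under `ShiftedAxialBound`** (`c = 22`; the uniform bound dominates). -/
theorem trinomialAffineLaw_of (hSA : ShiftedAxialBound) : TrinomialAffineLaw := by
  refine ⟨22, fun a b d t ρ κ w hw => (trinomialAffine_nv_le hSA w hw a b d ρ κ).trans ((trinomial_arith t).trans ?_)⟩
  exact Nat.le_mul_of_pos_left _ (pow_pos (by omega) 22)

end Summit.ValiantsHypothesis.ValiantsHypothesis.Theorems.TwoProducts.RankTwoJacobian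

end
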